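import Summits.QuantumFields.YangMills.Theorems.ColdStartUniversalityLatticeLangevinDiscreteGirsanov
import HarnessLib

/-!
# Route `ColdStartUniversality`, crux K_A1 `UniformColdStartMixing` (stmt-QuantumFields-24809), rung `stub_fixedCutoffMixing`:
# E-block — the discrete Girsanov weight has mass one and a uniformly bounded second moment

Helper file (seat `ym-line-csu-p1`, g7).  For the weight `Z(x) = ∏_i exp(Θ_i(x)·x_i - h|Θ_i(x)|²/2)` of
`integral_comp_shift_mul_girsanovWeight` (predictable `Θ` with `|Θ_{i,k}| ≤ R` on `((ℝ^d)^n, ⊗ gaussVec d h)`):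
`∫ Z dμ = 1` (`integral_girsanovWeight`) and `∫ Z² dμ ≤ exp(n h d R²)` (`integral_girsanovWeight_sq_le`; `Z_Θ² = Z_{2Θ} ·
∏ exp(h|Θ_i|²)`), i.e. `E (Z^h)² ≤ e^{t d R²}` along an Euler grid of `n = t/h` steps — the uniform integrability used in the
`h → 0` limit of the discrete Girsanov formula.  No definition, no sorry.  RECORD-rung R3 plumbing; nothing here bears on the
mass gap.
-/

set_option autoImplicit false

noncomputable section

namespace Summit.QuantumFields.YangMills.Theorems.ColdStartUniversality

open MeasureTheory ProbabilityTheory Filter Finset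
open scoped NNReal ENNReal BigOperators
open Literature.Probability.Process (gaussVec)

/-- **The Girsanov weight has mass one**: `∫ ∏_i exp(Θ_i·x_i - h|Θ_i|²/2) dμ = 1`. [folklore] -/
theorem integral_girsanovWeight (n d : ℕ) {h : ℝ≥0} (hh : h ≠ 0)
    (Θ : Fin n → (Fin n → (Fin d → ℝ)) → (Fin d → ℝ)) (hΘm : ∀ i, Measurable (Θ i)) {R : ℝ} (hR : ∀ i x k, |Θ i x k| ≤ R)
    (hpred : ∀ (i : Fin n) (x x' : Fin n → (Fin d → ℝ)), (∀ j, j < i → x j = x' j) → Θ i x = Θ i x') :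
    ∫ x, ∏ i, Real.exp (∑ k, Θ i x k * x i k - (h : ℝ) * (∑ k, Θ i x k ^ 2) / 2)
        ∂(Measure.pi fun _ : Fin n => gaussVec d h) = 1 := by
  haveI : IsProbabilityMeasure (gaussVec d h) := by unfold gaussVec; infer_instance
  have h1 := integral_comp_shift_mul_girsanovWeight n d hh Θ hΘm hR hpred (G := fun _ => (1 : ℝ)) measurable_const
    (C := 1) (fun _ => by simp)
  simp only [one_mul, integral_const, smul_eq_mul, mul_one, probReal_univ] at h1
  exact h1

/-- **Second moment of the Girsanov weight**: `∫ Z² dμ ≤ exp(n h d R²)`. [folklore] -/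
theorem integral_girsanovWeight_sq_le (n d : ℕ) {h : ℝ≥0} (hh : h ≠ 0)
    (Θ : Fin n → (Fin n → (Fin d → ℝ)) → (Fin d → ℝ)) (hΘm : ∀ i, Measurable (Θ i)) {R : ℝ} (hR : ∀ i x k, |Θ i x k| ≤ R)
    (hpred : ∀ (i : Fin n) (x x' : Fin n → (Fin d → ℝ)), (∀ j, j < i → x j = x' j) → Θ i x = Θ i x') :
    ∫ x, (∏ i, Real.exp (∑ k, Θ i x k * x i k - (h : ℝ) * (∑ k, Θ i x k ^ 2) / 2)) ^ 2
        ∂(Measure.pi fun _ : Fin n => gaussVec d h) ≤ Real.exp (n * (h : ℝ) * d * R ^ 2) := by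
  haveI : IsProbabilityMeasure (gaussVec d h) := by unfold gaussVec; infer_instance
  -- `Z_Θ² = Z_{2Θ} · ∏ exp(h |Θ_i|²) ≤ Z_{2Θ} · exp(n h d R²)`
  have hmass := integral_girsanovWeight n d hh (fun i x => (2 : ℝ) • Θ i x) (fun i => by exact (hΘm i).const_smul (2 : ℝ))
    (R := 2 * R) (fun i x k => by
      rw [Pi.smul_apply, smul_eq_mul, abs_mul, abs_two]
      exact mul_le_mul_of_nonneg_left (hR i x k) (by norm_num))
    (fun i x x' hxx' => by rw [hpred i x x' hxx'])
  have hpt : ∀ x : Fin n → (Fin d → ℝ),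
      (∏ i, Real.exp (∑ k, Θ i x k * x i k - (h : ℝ) * (∑ k, Θ i x k ^ 2) / 2)) ^ 2 ≤
        Real.exp (n * (h : ℝ) * d * R ^ 2) *
          ∏ i, Real.exp (∑ k, ((2 : ℝ) • Θ i x) k * x i k - (h : ℝ) * (∑ k, ((2 : ℝ) • Θ i x) k ^ 2) / 2) := by
    intro x
    rw [← Finset.prod_pow]
    have hsq : ∀ i, Real.exp (∑ k, Θ i x k * x i k - (h : ℝ) * (∑ k, Θ i x k ^ 2) / 2) ^ 2 =
        Real.exp ((h : ℝ) * ∑ k, Θ i x k ^ 2) *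
          Real.exp (∑ k, ((2 : ℝ) • Θ i x) k * x i k - (h : ℝ) * (∑ k, ((2 : ℝ) • Θ i x) k ^ 2) / 2) := by
      intro i
      rw [sq, ← Real.exp_add, ← Real.exp_add]
      congr 1
      simp only [Pi.smul_apply, smul_eq_mul]
      have : ∑ k, (2 * Θ i x k) ^ 2 = 4 * ∑ k, Θ i x k ^ 2 := by
        rw [Finset.mul_sum]; exact Finset.sum_congr rfl fun k _ => by ring
      rw [this]
      have : ∑ k, 2 * Θ i x k * x i k = 2 * ∑ k, Θ i x k * x i k := by
        rw [Finset.mul_sum]; exact Finset.sum_congr rfl fun k _ => by ring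
      rw [this]; ring
    simp_rw [hsq]
    rw [Finset.prod_mul_distrib]
    refine mul_le_mul_of_nonneg_right ?_ (Finset.prod_nonneg fun i _ => (Real.exp_pos _).le)
    rw [← Real.exp_sum, Real.exp_le_exp]
    have hbd : ∀ i, (h : ℝ) * ∑ k, Θ i x k ^ 2 ≤ (h : ℝ) * (d * R ^ 2) := fun i => by
      refine mul_le_mul_of_nonneg_left ?_ h.2
      calc ∑ k, Θ i x k ^ 2 ≤ ∑ _k : Fin d, R ^ 2 := Finset.sum_le_sum fun k _ => by
              have := hR i x k
              rw [← sq_abs]; exact pow_le_pow_left₀ (abs_nonneg _) this 2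
        _ = d * R ^ 2 := by rw [Finset.sum_const, Finset.card_univ, Fintype.card_fin, nsmul_eq_mul]
    calc ∑ i, (h : ℝ) * ∑ k, Θ i x k ^ 2 ≤ ∑ _i : Fin n, (h : ℝ) * (d * R ^ 2) := Finset.sum_le_sum fun i _ => hbd i
      _ = n * (h : ℝ) * d * R ^ 2 := by rw [Finset.sum_const, Finset.card_univ, Fintype.card_fin, nsmul_eq_mul]; ring
  -- integrate
  have hint2 : Integrable (fun x : Fin n → (Fin d → ℝ) =>
      ∏ i, Real.exp (∑ k, ((2 : ℝ) • Θ i x) k * x i k - (h : ℝ) * (∑ k, ((2 : ℝ) • Θ i x) k ^ 2) / 2))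
      (Measure.pi fun _ : Fin n => gaussVec d h) := by
    by_contra hni
    rw [integral_undef hni] at hmass
    exact zero_ne_one hmass
  calc ∫ x, (∏ i, Real.exp (∑ k, Θ i x k * x i k - (h : ℝ) * (∑ k, Θ i x k ^ 2) / 2)) ^ 2
        ∂(Measure.pi fun _ : Fin n => gaussVec d h)
      ≤ ∫ x, Real.exp (n * (h : ℝ) * d * R ^ 2) *
          ∏ i, Real.exp (∑ k, ((2 : ℝ) • Θ i x) k * x i k - (h : ℝ) * (∑ k, ((2 : ℝ) • Θ i x) k ^ 2) / 2)
        ∂(Measure.pi fun _ : Fin n => gaussVec d h) := by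
        refine integral_mono_of_nonneg (Eventually.of_forall fun x => sq_nonneg _) (hint2.const_mul _)
          (Eventually.of_forall hpt)
    _ = Real.exp (n * (h : ℝ) * d * R ^ 2) := by rw [integral_const_mul, hmass, mul_one]

end Summit.QuantumFields.YangMills.Theorems.ColdStartUniversality

end
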